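import Literature.NumberTheory.LFunctions.GranvilleMollinLinnikZeros
import Mathlib.Analysis.SpecialFunctions.Gamma.Beta
import HarnessLib

/-!
# The truncated explicit formula for `ψ(x, χ)`: the zeros of `L(s, χ)` outside the critical strip
# (Montgomery–Vaughan Cor. 10.8, Thm. 10.17 conventions)

Topic `Literature/NumberTheory/LFunctions`. THEOREMS (everything proved). First support file of the
discharge of the named fact `Literature.NumberTheory.LFunctions.truncatedExplicitFormula_psiChar`
(`ExplicitFormulaPsiChar.lean`, Montgomery–Vaughan Thm. 12.10). For a primitive character `χ`
modulo `q > 1` we record, from Mathlib's functional equation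
`Λ(1 − s, χ) = q^{s − 1/2} ε(χ) Λ(s, χ̄)` (`DirichletCharacter.IsPrimitive.completedLFunction_one_sub`)
and `L(s, χ) = Λ(s, χ)/γ(s, χ)` (`γ = Γ_ℝ(s + a)`, `a ∈ {0, 1}` the parity):

* `completedLFunction_ne_zero_of_re_nonpos` / `_of_one_le_re` — `Λ(s, χ) ≠ 0` for `Re s ≤ 0` and
  for `Re s ≥ 1`;
* `LFunction_eq_zero_iff_gammaFactor` — in `Re s ≤ 0` the zeros of `L(s, χ)` are exactly the poles
  of the Gamma factor, i.e. the trivial zeros `s = −2n − a` (MV Cor. 10.8), and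
  `re_mem_Ioo_of_LFunction_eq_zero`: every other zero lies in `0 < Re s < 1`;
* `zeroOrder_trivialZero` — the trivial zeros are simple (the poles of `Γ` are simple:
  `analyticOrderAt_Gamma_inv_neg_nat`);
* `zeroOrder_one_sub_eq_inv` — `m_χ(1 − ρ) = m_{χ̄}(ρ)` in the critical strip (MV Cor. 10.8: the
  functional equation preserves multiplicities), the reflection used to count the zeros with
  `Re ρ < 1/2` from the right half of the strip.

Multiplicities are the tree's `Literature.NumberTheory.LFunctions.DirichletDisc.zeroOrder`
(`DirichletLogDerivDisc.lean`); the elementary facts `ε(χ) ≠ 0`, `γ(s, χ) ≠ 0` in `Re s > 0`,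
`ord L = ord Λ` in `Re s > 0` are the tree's (`GranvilleMollinLinnikZeros.lean`, namespace
`SiegelZero`, where the reflection is proved for quadratic `χ`; here `χ̄ = χ⁻¹` is general).

## References

* H. L. Montgomery, R. C. Vaughan, *Multiplicative Number Theory I. Classical Theory*, CUP 2007,
  §10.1 Corollary 10.8, Theorem 10.17; §12.1 Theorem 12.10. [MontgomeryVaughan2007]
-/

noncomputable section

open Complex Filter Topology Set
open scoped Real

namespace Literature.NumberTheory.LFunctions

namespace ExplicitPsiChar

open DirichletCharacter Literature.NumberTheory.LFunctions.SiegelZero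

variable {q : ℕ} [NeZero q] {χ : DirichletCharacter ℂ q}

/-! ### Parity, the Gamma factor, the inverse character -/

omit [NeZero q] in
/-- The Gamma factor is `Γ_ℝ(s + a)` with `a = 0` (`χ` even) or `a = 1` (`χ` odd). [folklore] -/
theorem exists_gammaFactor_eq (χ : DirichletCharacter ℂ q) :
    ∃ a : ℝ, (a = 0 ∨ a = 1) ∧ ∀ s : ℂ, gammaFactor χ s = Gammaℝ (s + a) := by
  rcases χ.even_or_odd with h | h
  · exact ⟨0, Or.inl rfl, fun s ↦ by rw [h.gammaFactor_def]; simp⟩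
  · exact ⟨1, Or.inr rfl, fun s ↦ by rw [h.gammaFactor_def]; simp⟩

omit [NeZero q] in
/-- `χ̄ = χ⁻¹` has the same parity as `χ`: `χ⁻¹` is even iff `χ` is (`χ⁻¹(−1) = χ(−1)⁻¹ = χ(−1)`
as `χ(−1)² = 1`). [folklore] -/
theorem even_inv_iff (χ : DirichletCharacter ℂ q) : χ⁻¹.Even ↔ χ.Even := by
  have h : χ⁻¹ (-1) = χ (-1) := by
    rw [MulChar.inv_apply_eq_inv']
    have h2 : χ (-1) * χ (-1) = 1 := by rw [← map_mul]; simp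
    exact inv_eq_of_mul_eq_one_right h2
  rw [DirichletCharacter.Even, DirichletCharacter.Even, h]

omit [NeZero q] in
/-- `χ⁻¹` is odd iff `χ` is. [folklore] -/
theorem odd_inv_iff (χ : DirichletCharacter ℂ q) : χ⁻¹.Odd ↔ χ.Odd := by
  have h : χ⁻¹ (-1) = χ (-1) := by
    rw [MulChar.inv_apply_eq_inv']
    have h2 : χ (-1) * χ (-1) = 1 := by rw [← map_mul]; simp
    exact inv_eq_of_mul_eq_one_right h2
  rw [DirichletCharacter.Odd, DirichletCharacter.Odd, h]

omit [NeZero q] in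
/-- The Gamma factors of `χ` and `χ̄` coincide. [folklore] -/
theorem gammaFactor_inv (χ : DirichletCharacter ℂ q) (s : ℂ) :
    gammaFactor χ⁻¹ s = gammaFactor χ s := by
  rcases χ.even_or_odd with h | h
  · rw [h.gammaFactor_def, ((even_inv_iff χ).2 h).gammaFactor_def]
  · rw [h.gammaFactor_def, ((odd_inv_iff χ).2 h).gammaFactor_def]

/-- For a primitive character modulo `q > 1`, `χ ≠ χ₀`. [folklore] -/
theorem ne_one_of_isPrimitive (hprim : χ.IsPrimitive) (hq : 1 < q) : χ ≠ 1 := by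
  intro h
  rw [h, DirichletCharacter.IsPrimitive, conductor_one] at hprim
  omega

omit [NeZero q] in
/-- The zeros of the Gamma factor of an even character (the poles of `Γ_ℝ`): `s = −2n`.
[folklore] -/
theorem gammaFactor_eq_zero_iff_of_even (hχ : χ.Even) (s : ℂ) :
    gammaFactor χ s = 0 ↔ ∃ n : ℕ, s = -(2 * (n : ℂ)) := by
  rw [hχ.gammaFactor_def, Gammaℝ_eq_zero_iff]

omit [NeZero q] in
/-- The zeros of the Gamma factor of an odd character: `s + 1 = −2n`, i.e. `s = −2n − 1`.
[folklore] -/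
theorem gammaFactor_eq_zero_iff_of_odd (hχ : χ.Odd) (s : ℂ) :
    gammaFactor χ s = 0 ↔ ∃ n : ℕ, s + 1 = -(2 * (n : ℂ)) := by
  rw [hχ.gammaFactor_def, Gammaℝ_eq_zero_iff]

omit [NeZero q] in
/-- A zero of the Gamma factor is real with `Re s ≤ 0`. [folklore] -/
theorem im_eq_zero_of_gammaFactor_eq_zero (χ : DirichletCharacter ℂ q) {s : ℂ}
    (h : gammaFactor χ s = 0) : s.im = 0 ∧ s.re ≤ 0 := by
  rcases χ.even_or_odd with hχ | hχ
  · obtain ⟨n, hn⟩ := (gammaFactor_eq_zero_iff_of_even hχ s).1 h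
    rw [hn]
    simp
  · obtain ⟨n, hn⟩ := (gammaFactor_eq_zero_iff_of_odd hχ s).1 h
    rw [eq_sub_of_add_eq hn]
    constructor
    · simp
    · simp only [sub_re, neg_re, mul_re, re_ofNat, natCast_re, im_ofNat, natCast_im, mul_zero,
        sub_zero, one_re]
      linarith [(n.cast_nonneg : (0 : ℝ) ≤ n)]

/-- `L(·, χ) = Λ(·, χ) · γ(·, χ)⁻¹` as functions (`χ ≠ χ₀`, so `q ≠ 1`). [folklore] -/
theorem LFunction_eq_completed_mul_inv (hχ : χ ≠ 1) :
    χ.LFunction = fun s ↦ completedLFunction χ s * (gammaFactor χ s)⁻¹ := by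
  funext s
  rw [LFunction_eq_completed_div_gammaFactor χ s (Or.inr (level_ne_one hχ)), div_eq_mul_inv]

/-! ### `Λ(s, χ) ≠ 0` outside the critical strip -/

/-- `Λ(s, χ) = L(s, χ) γ(s, χ) ≠ 0` for `Re s ≥ 1` (`χ ≠ χ₀`). [folklore] -/
theorem completedLFunction_ne_zero_of_one_le_re (hχ : χ ≠ 1) {s : ℂ} (hs : 1 ≤ s.re) :
    completedLFunction χ s ≠ 0 := by
  intro h
  have hL : χ.LFunction s = 0 := by
    rw [LFunction_eq_completed_div_gammaFactor χ s (Or.inr (level_ne_one hχ)), h, zero_div]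
  exact LFunction_ne_zero_of_one_le_re χ (Or.inl hχ) hs hL

/-- **The functional equation, solved for `Λ(s, χ)`**: `Λ(s, χ) = q^{1/2 − s} ε(χ) Λ(1 − s, χ̄)`.
[cite: MontgomeryVaughan2007, Corollary 10.8] -/
theorem completedLFunction_eq_mul_one_sub (hprim : χ.IsPrimitive) (s : ℂ) :
    completedLFunction χ s =
      (q : ℂ) ^ (1 / 2 - s) * χ.rootNumber * completedLFunction χ⁻¹ (1 - s) := by
  have h := DirichletCharacter.IsPrimitive.completedLFunction_one_sub hprim (1 - s)
  rw [sub_sub_cancel] at h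
  rw [h]
  congr 2
  ring_nf

/-- **`Λ(s, χ) ≠ 0` for `Re s ≤ 0`** (primitive `χ ≠ χ₀`): by the functional equation this is
`q^{1/2−s} ε(χ) Λ(1 − s, χ̄)` with `Re(1 − s) ≥ 1`. [cite: MontgomeryVaughan2007, Corollary 10.8] -/
theorem completedLFunction_ne_zero_of_re_nonpos (hprim : χ.IsPrimitive) (hχ : χ ≠ 1) {s : ℂ}
    (hs : s.re ≤ 0) : completedLFunction χ s ≠ 0 := by
  rw [completedLFunction_eq_mul_one_sub hprim s]
  have hq0 : (q : ℂ) ≠ 0 := Nat.cast_ne_zero.2 (NeZero.ne q)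
  refine mul_ne_zero (mul_ne_zero ?_ (rootNumber_ne_zero hprim hχ)) ?_
  · rw [Ne, cpow_eq_zero_iff, not_and_or]
    exact Or.inl hq0
  · exact completedLFunction_ne_zero_of_one_le_re (inv_ne_one.mpr hχ) (by simp; linarith)

/-! ### The zeros of `L(s, χ)` in `Re s ≤ 0` are the trivial zeros -/

/-- **The zeros in `Re s ≤ 0`** (primitive `χ ≠ χ₀`): `L(s, χ) = 0 ↔ γ(s, χ)⁻¹ = 0`, i.e. `s` is a
pole of the Gamma factor (a trivial zero `−2n − a`). [cite: MontgomeryVaughan2007, Corollary 10.8] -/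
theorem LFunction_eq_zero_iff_gammaFactor (hprim : χ.IsPrimitive) (hχ : χ ≠ 1) {s : ℂ}
    (hs : s.re ≤ 0) : χ.LFunction s = 0 ↔ gammaFactor χ s = 0 := by
  rw [LFunction_eq_completed_div_gammaFactor χ s (Or.inr (level_ne_one hχ)), div_eq_zero_iff]
  have := completedLFunction_ne_zero_of_re_nonpos hprim hχ hs
  tauto

/-- The trivial zeros of an even primitive character: for `Re s ≤ 0`, `L(s, χ) = 0 ↔ s = −2n`.
[cite: MontgomeryVaughan2007, Corollary 10.8] -/
theorem LFunction_eq_zero_iff_of_even (hprim : χ.IsPrimitive) (hχ : χ ≠ 1) (heven : χ.Even)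
    {s : ℂ} (hs : s.re ≤ 0) : χ.LFunction s = 0 ↔ ∃ n : ℕ, s = -(2 * (n : ℂ)) := by
  rw [LFunction_eq_zero_iff_gammaFactor hprim hχ hs, gammaFactor_eq_zero_iff_of_even heven]

/-- The trivial zeros of an odd primitive character: for `Re s ≤ 0`, `L(s, χ) = 0 ↔ s = −2n − 1`.
[cite: MontgomeryVaughan2007, Corollary 10.8] -/
theorem LFunction_eq_zero_iff_of_odd (hprim : χ.IsPrimitive) (hχ : χ ≠ 1) (hodd : χ.Odd)
    {s : ℂ} (hs : s.re ≤ 0) : χ.LFunction s = 0 ↔ ∃ n : ℕ, s + 1 = -(2 * (n : ℂ)) := by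
  rw [LFunction_eq_zero_iff_gammaFactor hprim hχ hs, gammaFactor_eq_zero_iff_of_odd hodd]

/-- A zero of `L(s, χ)` off the real axis, or with `Re s ≤ 0` not of the form `−2n − a`, lies in
the open critical strip: if `L(ρ, χ) = 0` and `γ(ρ, χ) ≠ 0` then `0 < Re ρ < 1`.
[cite: MontgomeryVaughan2007, Corollary 10.8] -/
theorem re_mem_Ioo_of_LFunction_eq_zero (hprim : χ.IsPrimitive) (hχ : χ ≠ 1) {ρ : ℂ}
    (hρ : χ.LFunction ρ = 0) (hγ : gammaFactor χ ρ ≠ 0) : 0 < ρ.re ∧ ρ.re < 1 := by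
  constructor
  · by_contra h
    exact hγ ((LFunction_eq_zero_iff_gammaFactor hprim hχ (not_lt.1 h)).1 hρ)
  · by_contra h
    exact LFunction_ne_zero_of_one_le_re χ (Or.inl hχ) (not_lt.1 h) hρ

/-- A zero off the real axis lies in the open critical strip. [cite: MontgomeryVaughan2007, Corollary 10.8] -/
theorem re_mem_Ioo_of_LFunction_eq_zero_of_im_ne_zero (hprim : χ.IsPrimitive) (hχ : χ ≠ 1)
    {ρ : ℂ} (hρ : χ.LFunction ρ = 0) (him : ρ.im ≠ 0) : 0 < ρ.re ∧ ρ.re < 1 :=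
  re_mem_Ioo_of_LFunction_eq_zero hprim hχ hρ fun h ↦ him (im_eq_zero_of_gammaFactor_eq_zero χ h).1

/-- `L(σ + it, χ) ≠ 0` for `σ ≤ 0` and `t ≠ 0`. [cite: MontgomeryVaughan2007, Corollary 10.8] -/
theorem LFunction_ne_zero_of_re_nonpos_of_im_ne_zero (hprim : χ.IsPrimitive) (hχ : χ ≠ 1)
    {s : ℂ} (hs : s.re ≤ 0) (him : s.im ≠ 0) : χ.LFunction s ≠ 0 := fun h ↦ by
  have := (re_mem_Ioo_of_LFunction_eq_zero_of_im_ne_zero hprim hχ h him).1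
  linarith

/-- `L(s, χ) ≠ 0` at a point of `Re s ≤ 0` which is not a trivial zero (`γ(s, χ) ≠ 0`).
[cite: MontgomeryVaughan2007, Corollary 10.8] -/
theorem LFunction_ne_zero_of_re_nonpos_of_gammaFactor_ne_zero (hprim : χ.IsPrimitive)
    (hχ : χ ≠ 1) {s : ℂ} (hs : s.re ≤ 0) (hne : gammaFactor χ s ≠ 0) : χ.LFunction s ≠ 0 :=
  fun h ↦ hne ((LFunction_eq_zero_iff_gammaFactor hprim hχ hs).1 h)

omit [NeZero q] in
/-- A real `σ ≤ 0` that is not an integer is no trivial zero: `γ(σ + it, χ) ≠ 0` whenever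
`σ ∉ ℤ` (used for `σ = −1/2`, `σ = −2K − 1/2`). [folklore] -/
theorem gammaFactor_ne_zero_of_not_int (χ : DirichletCharacter ℂ q) {s : ℂ}
    (hs : ∀ m : ℤ, s.re ≠ m) : gammaFactor χ s ≠ 0 := by
  intro h
  rcases χ.even_or_odd with hχ | hχ
  · obtain ⟨n, hn⟩ := (gammaFactor_eq_zero_iff_of_even hχ s).1 h
    refine hs (-(2 * (n : ℤ))) ?_
    rw [hn]; simp
  · obtain ⟨n, hn⟩ := (gammaFactor_eq_zero_iff_of_odd hχ s).1 h
    refine hs (-(2 * (n : ℤ)) - 1) ?_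
    rw [eq_sub_of_add_eq hn]; simp

/-- For an odd primitive character, `L(0, χ) ≠ 0`. [cite: MontgomeryVaughan2007, Corollary 10.8] -/
theorem LFunction_zero_ne_zero_of_odd (hprim : χ.IsPrimitive) (hχ : χ ≠ 1) (hodd : χ.Odd) :
    χ.LFunction 0 ≠ 0 := by
  refine LFunction_ne_zero_of_re_nonpos_of_gammaFactor_ne_zero hprim hχ (by simp) fun h ↦ ?_
  obtain ⟨n, hn⟩ := (gammaFactor_eq_zero_iff_of_odd hodd 0).1 h
  have := congrArg Complex.re hn
  simp at this
  linarith [(n.cast_nonneg : (0 : ℝ) ≤ n)]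

/-- For an even primitive character modulo `q > 1`, `L(0, χ) = 0`. [cite: MontgomeryVaughan2007, Corollary 10.8] -/
theorem LFunction_zero_eq_zero_of_even (hprim : χ.IsPrimitive) (hχ : χ ≠ 1) (heven : χ.Even) :
    χ.LFunction 0 = 0 :=
  (LFunction_eq_zero_iff_of_even hprim hχ heven (by simp)).2 ⟨0, by simp⟩

/-! ### Multiplicities: `L` versus `Λ`, and the reflection `ρ ↦ 1 − ρ` -/

/-- **The functional equation preserves multiplicities**: `ord_{1−s} Λ(·, χ) = ord_s Λ(·, χ̄)`
for a primitive `χ ≠ χ₀` and every `s`. [cite: MontgomeryVaughan2007, Corollary 10.8] -/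
theorem analyticOrderAt_completed_one_sub (hprim : χ.IsPrimitive) (hχ : χ ≠ 1) (s : ℂ) :
    analyticOrderAt (completedLFunction χ) (1 - s) =
      analyticOrderAt (completedLFunction χ⁻¹) s := by
  have hq0 : (q : ℂ) ≠ 0 := Nat.cast_ne_zero.2 (NeZero.ne q)
  have hε := rootNumber_ne_zero hprim hχ
  have hcomp : analyticOrderAt (completedLFunction χ ∘ fun z : ℂ ↦ 1 - z) s =
      analyticOrderAt (completedLFunction χ) (1 - s) := by
    refine analyticOrderAt_comp_of_deriv_ne_zero (f := completedLFunction χ)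
      (g := fun z : ℂ ↦ 1 - z) ?_ ?_
    · exact (analyticAt_const.sub analyticAt_id)
    · rw [deriv_const_sub, deriv_id'']; norm_num
  have hfun : (completedLFunction χ ∘ fun z : ℂ ↦ 1 - z) =
      (fun z : ℂ ↦ (q : ℂ) ^ (z - 1 / 2) * χ.rootNumber) * completedLFunction χ⁻¹ := by
    funext z
    rw [Function.comp_apply, Pi.mul_apply,
      DirichletCharacter.IsPrimitive.completedLFunction_one_sub hprim z]
  have hH : AnalyticAt ℂ (fun z : ℂ ↦ (q : ℂ) ^ (z - 1 / 2) * χ.rootNumber) s := by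
    refine Differentiable.analyticAt (fun z ↦ ?_) s
    exact ((differentiableAt_id.sub_const _).const_cpow (Or.inl hq0)).mul_const _
  have hH0 : analyticOrderAt (fun z : ℂ ↦ (q : ℂ) ^ (z - 1 / 2) * χ.rootNumber) s = 0 := by
    refine hH.analyticOrderAt_eq_zero.2 (mul_ne_zero ?_ hε)
    rw [Ne, cpow_eq_zero_iff, not_and_or]
    exact Or.inl hq0
  have hΛ : AnalyticAt ℂ (completedLFunction χ⁻¹) s :=
    (differentiable_completedLFunction (inv_ne_one.mpr hχ)).analyticAt s
  rw [← hcomp, hfun, analyticOrderAt_mul hH hΛ, hH0, zero_add]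

/-- **MV Corollary 10.8 (multiplicities)**: for a primitive `χ ≠ χ₀` and `ρ` in the critical
strip `0 < Re ρ < 1`, `m_χ(1 − ρ) = m_{χ̄}(ρ)`. [cite: MontgomeryVaughan2007, Corollary 10.8] -/
theorem zeroOrder_one_sub_eq_inv (hprim : χ.IsPrimitive) (hχ : χ ≠ 1) {ρ : ℂ} (h0 : 0 < ρ.re)
    (h1 : ρ.re < 1) : DirichletDisc.zeroOrder χ (1 - ρ) = DirichletDisc.zeroOrder χ⁻¹ ρ := by
  have h1' : 0 < (1 - ρ).re := by simp; linarith
  have key : analyticOrderAt χ.LFunction (1 - ρ) = analyticOrderAt χ⁻¹.LFunction ρ := by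
    rw [analyticOrderAt_LFunction_eq_completed hχ h1',
      analyticOrderAt_LFunction_eq_completed (inv_ne_one.mpr hχ) h0,
      analyticOrderAt_completed_one_sub hprim hχ]
  rw [DirichletDisc.zeroOrder, DirichletDisc.zeroOrder, analyticOrderNatAt, analyticOrderNatAt, key]

/-- **MV Corollary 10.8 (zero sets)**: for a primitive `χ ≠ χ₀` and `0 < Re ρ < 1`,
`L(1 − ρ, χ) = 0 ↔ L(ρ, χ̄) = 0`. [cite: MontgomeryVaughan2007, Corollary 10.8] -/
theorem LFunction_one_sub_eq_zero_iff (hprim : χ.IsPrimitive) (hχ : χ ≠ 1) {ρ : ℂ}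
    (h0 : 0 < ρ.re) (h1 : ρ.re < 1) : χ.LFunction (1 - ρ) = 0 ↔ χ⁻¹.LFunction ρ = 0 := by
  rw [← DirichletDisc.zeroOrder_pos_iff χ hχ, ← DirichletDisc.zeroOrder_pos_iff χ⁻¹ (inv_ne_one.mpr hχ),
    zeroOrder_one_sub_eq_inv hprim hχ h0 h1]

/-! ### The trivial zeros are simple -/

/-- **The poles of `Γ` are simple**: `1/Γ` has a simple zero at `−n`
(`1/Γ(s) = s(s+1)⋯(s+n)/Γ(s+n+1)`). [folklore] -/
theorem analyticOrderAt_Gamma_inv_neg_nat (n : ℕ) :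
    analyticOrderAt (fun s : ℂ ↦ (Complex.Gamma s)⁻¹) (-(n : ℂ)) = 1 := by
  -- `1/Γ(s) = (∏_{j ≤ n} (s + j)) / Γ(s + n + 1)`
  have hprod : ∀ (m : ℕ) (s : ℂ), (Complex.Gamma s)⁻¹ =
      (∏ j ∈ Finset.range (m + 1), (s + j)) * (Complex.Gamma (s + (m + 1 : ℕ)))⁻¹ := by
    intro m
    induction m with
    | zero =>
      intro s
      simp only [zero_add, Finset.range_one, Finset.prod_singleton, Nat.cast_zero, add_zero,
        Nat.cast_one]
      have := Complex.one_div_Gamma_eq_self_mul_one_div_Gamma_add_one s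
      simpa only [one_div] using this
    | succ m ih =>
      intro s
      rw [ih s, Finset.prod_range_succ _ (m + 1)]
      have h := Complex.one_div_Gamma_eq_self_mul_one_div_Gamma_add_one (s + (m + 1 : ℕ))
      rw [h]
      have e : s + ((m + 1 : ℕ) : ℂ) + 1 = s + ((m + 1 + 1 : ℕ) : ℂ) := by push_cast; ring
      rw [e]
      ring
  -- the regular factor `g(s) = (∏_{j < n} (s + j)) / Γ(s + n + 1)`, non-zero at `-n`
  set g : ℂ → ℂ := fun s ↦ (∏ j ∈ Finset.range n, (s + j)) * (Complex.Gamma (s + (n + 1 : ℕ)))⁻¹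
    with hg
  have hga : AnalyticAt ℂ g (-(n : ℂ)) := by
    refine Differentiable.analyticAt (fun s ↦ ?_) _
    refine DifferentiableAt.mul ?_ ?_
    · exact DifferentiableAt.fun_finsetProd fun j _ ↦ (differentiableAt_id.add_const (j : ℂ))
    · exact (Complex.differentiable_one_div_Gamma.comp (differentiable_id.add_const _)) s
  have hg0 : g (-(n : ℂ)) ≠ 0 := by
    simp only [hg]
    refine mul_ne_zero (Finset.prod_ne_zero_iff.2 fun j hj ↦ ?_) ?_
    · rw [Finset.mem_range] at hj
      have : (-(n : ℂ) + j) = (((j : ℝ) - n : ℝ) : ℂ) := by push_cast; ring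
      rw [this, Ne, Complex.ofReal_eq_zero, sub_eq_zero]
      exact_mod_cast (Nat.ne_of_lt hj)
    · have : (-(n : ℂ) + ((n + 1 : ℕ) : ℂ)) = 1 := by push_cast; ring
      rw [this, Complex.Gamma_one, inv_one]
      exact one_ne_zero
  have hfac : ∀ s : ℂ, (Complex.Gamma s)⁻¹ = (s - (-(n : ℂ))) ^ 1 • g s := by
    intro s
    rw [hprod n s, Finset.prod_range_succ, pow_one, smul_eq_mul, hg]
    ring
  have han : AnalyticAt ℂ (fun s : ℂ ↦ (Complex.Gamma s)⁻¹) (-(n : ℂ)) :=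
    Complex.differentiable_one_div_Gamma.analyticAt _
  have h1 : analyticOrderAt (fun s : ℂ ↦ (Complex.Gamma s)⁻¹) (-(n : ℂ)) = (1 : ℕ) :=
    (han.analyticOrderAt_eq_natCast).2 ⟨g, hga, hg0, Eventually.of_forall hfac⟩
  rw [h1, Nat.cast_one]

/-- `1/Γ_ℝ` has a simple zero at `−2n`. [folklore] -/
theorem analyticOrderAt_Gammaℝ_inv_neg (n : ℕ) :
    analyticOrderAt (fun s : ℂ ↦ (Gammaℝ s)⁻¹) (-(2 * (n : ℂ))) = 1 := by
  -- `(Γ_ℝ s)⁻¹ = π^{s/2} · (Γ(s/2))⁻¹`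
  have hfun : (fun s : ℂ ↦ (Gammaℝ s)⁻¹) =
      (fun s : ℂ ↦ (π : ℂ) ^ (s / 2)) * ((fun w : ℂ ↦ (Complex.Gamma w)⁻¹) ∘ fun s : ℂ ↦ s / 2) := by
    funext s
    simp only [Pi.mul_apply, Function.comp_apply, Gammaℝ_def, mul_inv, neg_div]
    rw [cpow_neg, inv_inv]
  have hπ : (π : ℂ) ≠ 0 := by exact_mod_cast Real.pi_ne_zero
  have h1 : AnalyticAt ℂ (fun s : ℂ ↦ (π : ℂ) ^ (s / 2)) (-(2 * (n : ℂ))) := by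
    refine Differentiable.analyticAt (fun s ↦ ?_) _
    exact (differentiableAt_id.div_const 2).const_cpow (Or.inl hπ)
  have h10 : analyticOrderAt (fun s : ℂ ↦ (π : ℂ) ^ (s / 2)) (-(2 * (n : ℂ))) = 0 := by
    refine h1.analyticOrderAt_eq_zero.2 ?_
    rw [Ne, cpow_eq_zero_iff, not_and_or]
    exact Or.inl hπ
  have h2 : AnalyticAt ℂ ((fun w : ℂ ↦ (Complex.Gamma w)⁻¹) ∘ fun s : ℂ ↦ s / 2) (-(2 * (n : ℂ))) :=
    (Complex.differentiable_one_div_Gamma.comp (differentiable_id.div_const 2)).analyticAt _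
  have hcomp : analyticOrderAt ((fun w : ℂ ↦ (Complex.Gamma w)⁻¹) ∘ fun s : ℂ ↦ s / 2)
      (-(2 * (n : ℂ))) = 1 := by
    rw [analyticOrderAt_comp_of_deriv_ne_zero (f := fun w : ℂ ↦ (Complex.Gamma w)⁻¹)
      (g := fun s : ℂ ↦ s / 2) (analyticAt_id.div analyticAt_const two_ne_zero)
      (by rw [deriv_div_const, deriv_id'']; norm_num)]
    have : (-(2 * (n : ℂ))) / 2 = -(n : ℂ) := by ring
    rw [this]
    exact analyticOrderAt_Gamma_inv_neg_nat n
  rw [hfun, analyticOrderAt_mul h1 h2, h10, hcomp, zero_add]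

omit [NeZero q] in
/-- `1/γ(·, χ)` has a simple zero at each of its zeros (the trivial zeros). [folklore] -/
theorem analyticOrderAt_gammaFactor_inv (χ : DirichletCharacter ℂ q) {s : ℂ}
    (hs0 : gammaFactor χ s = 0) :
    analyticOrderAt (fun z : ℂ ↦ (gammaFactor χ z)⁻¹) s = 1 := by
  rcases χ.even_or_odd with hχ | hχ
  · obtain ⟨n, hs⟩ := (gammaFactor_eq_zero_iff_of_even hχ s).1 hs0
    simp_rw [hχ.gammaFactor_def]
    rw [hs]
    exact analyticOrderAt_Gammaℝ_inv_neg n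
  · obtain ⟨n, hs⟩ := (gammaFactor_eq_zero_iff_of_odd hχ s).1 hs0
    simp_rw [hχ.gammaFactor_def]
    have hfun : (fun z : ℂ ↦ (Gammaℝ (z + 1))⁻¹) = (fun w : ℂ ↦ (Gammaℝ w)⁻¹) ∘ fun z : ℂ ↦ z + 1 := rfl
    rw [hfun, analyticOrderAt_comp_of_deriv_ne_zero (f := fun w : ℂ ↦ (Gammaℝ w)⁻¹)
      (g := fun z : ℂ ↦ z + 1) (analyticAt_id.add analyticAt_const)
      (by rw [deriv_add_const, deriv_id'']; norm_num), hs]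
    exact analyticOrderAt_Gammaℝ_inv_neg n

/-- **The trivial zeros are simple** (primitive `χ ≠ χ₀`): if `γ(s, χ) = 0` then `m_χ(s) = 1`
(`L = Λ · γ⁻¹` with `Λ(s) ≠ 0` in `Re s ≤ 0` and `γ⁻¹` vanishing simply).
[cite: MontgomeryVaughan2007, Theorem 10.17] -/
theorem zeroOrder_trivialZero (hprim : χ.IsPrimitive) (hχ : χ ≠ 1) {s : ℂ}
    (hs : gammaFactor χ s = 0) : DirichletDisc.zeroOrder χ s = 1 := by
  have hre : s.re ≤ 0 := (im_eq_zero_of_gammaFactor_eq_zero χ hs).2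
  have hΛ : AnalyticAt ℂ (completedLFunction χ) s :=
    (differentiable_completedLFunction hχ).analyticAt s
  have hG : AnalyticAt ℂ (fun s ↦ (gammaFactor χ s)⁻¹) s :=
    (differentiable_gammaFactor_inv χ).analyticAt s
  have hΛ0 : analyticOrderAt (completedLFunction χ) s = 0 :=
    hΛ.analyticOrderAt_eq_zero.2 (completedLFunction_ne_zero_of_re_nonpos hprim hχ hre)
  have key : analyticOrderAt χ.LFunction s = 1 := by
    rw [LFunction_eq_completed_mul_inv hχ]
    change analyticOrderAt ((completedLFunction χ) * fun s ↦ (gammaFactor χ s)⁻¹) s = _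
    rw [analyticOrderAt_mul hΛ hG, hΛ0, analyticOrderAt_gammaFactor_inv χ hs, zero_add]
  have h := cast_zeroOrder hχ s
  rw [key] at h
  exact_mod_cast h

/-- The zero of an even primitive `L(s, χ)` at `s = 0` is simple. [cite: MontgomeryVaughan2007, Theorem 10.17] -/
theorem zeroOrder_zero_of_even (hprim : χ.IsPrimitive) (hχ : χ ≠ 1) (heven : χ.Even) :
    DirichletDisc.zeroOrder χ 0 = 1 :=
  zeroOrder_trivialZero hprim hχ ((gammaFactor_eq_zero_iff_of_even heven 0).2 ⟨0, by simp⟩)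

/-- The multiplicity as the meromorphic order, for the weighted argument principle:
`(meromorphicOrderAt L ρ).untop₀ = m(ρ)`. [folklore] -/
theorem meromorphicOrderAt_untop₀ (hχ : χ ≠ 1) (ρ : ℂ) :
    ((meromorphicOrderAt χ.LFunction ρ).untop₀ : ℂ) = (DirichletDisc.zeroOrder χ ρ : ℂ) := by
  rw [DirichletDisc.meromorphicOrderAt_untop₀_eq_zeroOrder χ hχ ρ]
  simp

end ExplicitPsiChar

end Literature.NumberTheory.LFunctions

end
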